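import Mathlib
import HarnessLib
import Summits.HubbardSuperconductivity.HubbardSuperconductivity.Theorems.KLProgrammeKLRegimeTwoVolumeTowerStepCovZeroGram

/-!
# Route `KLProgramme` — crux K3, VL child `KLRegimeVolumeLimitV17F2` (stmt-HubbardSuperconductivity-20440), blueprint v5 M5: THE ENTRY SUP OF THE FIRST STEP
# COVARIANCE `klStepCov V M β μ K 0` AT ANY ADMISSIBLE FRAME, EVERY VOLUME (seat hubbard-kl-k3c4-p1 g14; `--supports` 20440)

Companion of `…TowerStepCovZeroGram`: the `entry` field of `ScaleCovData (klStepCov V M β μ K 0) …` (located «SCALE-0-STEPCOV», p3 g12).  The pullback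
`S(F̃_0)ᵀ·C^K_{(Λ_2,Λ_1]}·S(F̃_0)` is the pullback of a NORMAL covariance (`hubbardCovSliceCT_zero_seed`), hence antisymmetric
(`pullback_normalCovariance_transpose`), vanishes at equal charges (`pullback_normalCovariance_apply_of_charge_eq`) and is, at charges `(0,1)`, minus the inner
product of k3c4-p1 g2's Gram vectors (`contr_pullback_normalCovariance_eq_inner`), whose norms are bounded sector-free by
`norm_sq_sectorGramF/G_sliceCT_le` with the frame's level count `card_frameLevel_lt_le` — so every entry is below the SQUARE of the Gram constant of
`…TowerStepCovZeroGram`, a volume-free number: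

* **`norm_klStepCov_zero_apply_le`** — `‖klStepCov V M β μ K 0 Y Y′‖ ≤ 8(Λ_1β/π+3)(1793Λ_1+704)/(βΛ_1)` for every admissible frame, `β > 0`, every volume
  `V ≥ 1`, cutoff `M ≥ 1` and all labels.

With `isGramBoundedR_klStepCov_zero_of_frameOK` this gives the `gram`/`entry`/`κ_pos`/`sW_nonneg` part of `ScaleCovData (klStepCov … 0)`; the Λ-scaled rows
(`αW`) remain the isotropic `ℓ¹` bound of `…TowerStepCovZero`.  Proofs only; no definition. [cite: BenfattoGiulianiMastropietro2006, §2.8 (2.80)]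
-/

noncomputable section

namespace Summit.HubbardSuperconductivity.HubbardSuperconductivity.Theorems.TwoVolumeSource

set_option linter.dupNamespace false -- summit = problem name (single-conjunct summit), D-0017

open Finset Literature.MathematicalPhysics.QuantumLattice GrassmannAlgebra Literature.Probability.LatticeModels
open Literature.MathematicalPhysics.QuantumLattice.FermiRG
open Summit.HubbardSuperconductivity.HubbardSuperconductivity.Theorems.KLProgrammeLegKernels
open Summit.HubbardSuperconductivity.HubbardSuperconductivity.Theorems.KLRegimeSplit
open Summit.HubbardSuperconductivity.HubbardSuperconductivity.Theorems.EngineV8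
open Summit.HubbardSuperconductivity.HubbardSuperconductivity.Theorems.TwoVolumeDefect
open scoped InnerProductSpace

set_option maxHeartbeats 400000 in -- three charge cases over one explicit symbol
/-- **THE ENTRIES OF THE FIRST STEP COVARIANCE ARE BELOW A VOLUME-FREE CONSTANT** (see the module docstring).
[cite: BenfattoGiulianiMastropietro2006, §2.8 (2.80)] -/
theorem norm_klStepCov_zero_apply_le {V M : ℕ} [NeZero V] [NeZero M] {R : RenConsts} {U : ℝ} {N : ℕ} {μ : ℝ}
    {K : TrigPolyC4v} (hK : FrameOK R U N μ K) {β : ℝ} (hβ : 0 < β) (Y Y' : SpaceTimeIdx V M × SectorLeg (sectorCount 0)) :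
    ‖klStepCov V M β μ K 0 Y Y'‖ ≤ 8 * (klScale klE0 1 * β / Real.pi + 3) * (1793 * klScale klE0 1 + 704) / (β * klScale klE0 1) := by
  classical
  have hV : 1 ≤ V := Nat.pos_of_ne_zero (NeZero.ne V)
  have hΛ1 : 0 < klScale klE0 1 := klth_klScale_pos 1
  have hΛ2 : 0 < klScale klE0 (1 + 1) := klth_klScale_pos 2
  have hΛ21 : klScale klE0 (1 + 1) ≤ klScale klE0 1 := by rw [klth_klScale_succ]; linarith
  -- the symbol of the slice in normal form and the pullback
  set F := bgmFatMultiplier V M klE0 β (nambuXiCT V μ K) 0 with hF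
  set p : FreqMomentum V M × Fin 2 → ℂ := fun ks =>
    ((hubbardCutoffWeightCT V M β μ K (klScale klE0 (1 + 1)) ks.1 : ℂ) - (hubbardCutoffWeightCT V M β μ K (klScale klE0 1) ks.1 : ℂ)) *
      (((β * (V : ℝ) ^ 2 : ℝ) : ℂ) *
        ((Complex.I * matsubaraFreq β M ks.1.1 + nambuXiCT V μ K ks.1.2) / nambuDenCT V M β μ 0 K ks.1)) with hp
  set C' := (sectorSubMatrix V M β F).transpose * normalCovariance V M p * sectorSubMatrix V M β F with hC'
  have hC : klStepCov V M β μ K 0 = C' := by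
    show (sectorSubMatrix V M β F).transpose * hubbardCovSliceCT V M β μ 0 K (klScale klE0 (1 + 1)) (klScale klE0 1) * sectorSubMatrix V M β F = C'
    rw [hubbardCovSliceCT_zero_seed]
  rw [hC]
  -- the Gram vectors' norms (sector-free, frame level count)
  have hcount := card_frameLevel_lt_le (L := V) hK hΛ1 (klScale_klE0_lt_tube 1).le
  have hFn : ∀ ω k, ‖F ω k‖ ≤ 1 := fun ω k => norm_bgmFatMultiplier_le_one klE0 β (nambuXiCT V μ K) 0 ω k
  set B : ℝ := ‖((1 / (β * (V : ℝ) ^ 2) : ℝ) : ℂ)‖ ^ 2 *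
    (((klScale klE0 1 * β / Real.pi + 3) * (1793 * klScale klE0 1 * (V : ℝ) ^ 2 + 704 * V)) * (2 * (β * (V : ℝ) ^ 2) / klScale klE0 (1 + 1))) with hB
  have hB0 : 0 ≤ B := by rw [hB]; have := hΛ2.le; positivity
  have hFY : ∀ Z, ‖sectorGramF V M β F p Z‖ ≤ Real.sqrt B := fun Z => by
    rw [← Real.sqrt_sq (norm_nonneg _)]
    exact Real.sqrt_le_sqrt (by simpa only [hp] using norm_sq_sectorGramF_sliceCT_le (L := V) (M := M) hβ μ K hΛ2 hΛ21 hcount F hFn Z)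
  have hGY : ∀ Z, ‖sectorGramG V M β F p Z‖ ≤ Real.sqrt B := fun Z => by
    rw [← Real.sqrt_sq (norm_nonneg _)]
    exact Real.sqrt_le_sqrt (by simpa only [hp] using norm_sq_sectorGramG_sliceCT_le (L := V) (M := M) hβ μ K hΛ2 hΛ21 hcount F hFn Z)
  -- `B` is the square of the Gram constant of `…TowerStepCovZeroGram`, below the volume-free number
  have hBle : B ≤ 8 * (klScale klE0 1 * β / Real.pi + 3) * (1793 * klScale klE0 1 + 704) / (β * klScale klE0 1) := by
    have h8 : 2 * (β * (V : ℝ) ^ 2) / klScale klE0 (1 + 1) = 8 * (β * (V : ℝ) ^ 2) / klScale klE0 1 := by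
      rw [klth_klScale_succ]; field_simp; ring
    rw [hB, h8]
    exact stepCovZero_gramConst_le hV hβ
  -- the bound at charges `(0, 1)`
  have hanti : ∀ Z Z', C' Z' Z = -C' Z Z' := fun Z Z' => by
    have h := congrFun (congrFun (pullback_normalCovariance_transpose β F p) Z) Z'
    rwa [Matrix.transpose_apply, Matrix.neg_apply] at h
  have h01 : ∀ Z Z', Z.2.2 = 0 → Z'.2.2 = 1 → ‖C' Z Z'‖ ≤ B := by
    intro Z Z' hZ hZ'
    have hcontr := contr_pullback_normalCovariance_eq_inner β F p hZ hZ'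
    have hce : contr ℂ C' Z Z' = -C' Z Z' := by
      rw [contr_apply, hanti Z Z', show ((1 / 2 : ℚ) • (1 : ℂ)) * (-C' Z Z' - C' Z Z') = -C' Z Z' by
        rw [Rat.smul_one_eq_cast]; push_cast; ring]
    have hentry : C' Z Z' = -⟪sectorGramF V M β F p Z, sectorGramG V M β F p Z'⟫_ℂ := by
      rw [← hcontr, hce, neg_neg]
    rw [hentry, norm_neg]
    calc ‖⟪sectorGramF V M β F p Z, sectorGramG V M β F p Z'⟫_ℂ‖ ≤ ‖sectorGramF V M β F p Z‖ * ‖sectorGramG V M β F p Z'‖ := norm_inner_le_norm _ _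
      _ ≤ Real.sqrt B * Real.sqrt B := mul_le_mul (hFY Z) (hGY Z') (norm_nonneg _) (Real.sqrt_nonneg _)
      _ = B := Real.mul_self_sqrt hB0
  -- the three charge cases
  refine le_trans ?_ hBle
  by_cases hc : Y.2.2 = Y'.2.2
  · rw [hC', pullback_normalCovariance_apply_of_charge_eq β F p hc, norm_zero]; exact hB0
  · rcases Fin.eq_zero_or_eq_succ (Y.2.2) with hY0 | ⟨j0, hYs⟩
    · have hY'1 : Y'.2.2 = 1 := by
        have : Y'.2.2 ≠ 0 := fun h => hc (hY0.trans h.symm)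
        exact Fin.eq_one_of_ne_zero _ this
      exact h01 Y Y' hY0 hY'1
    · have hY1 : Y.2.2 = 1 := by rw [hYs]; exact Subsingleton.elim (α := Fin 1) j0 0 ▸ rfl
      have hY'0 : Y'.2.2 = 0 := by
        by_contra h
        exact hc (hY1.trans (Fin.eq_one_of_ne_zero _ h).symm)
      have h := h01 Y' Y hY'0 hY1
      rw [hanti Y Y', norm_neg] at h
      exact h

end Summit.HubbardSuperconductivity.HubbardSuperconductivity.Theorems.TwoVolumeSource

end
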